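import Mathlib
import Literature.Analysis.FluidPDE.SpaceTimeRescaling
import Literature.Analysis.FluidPDE.SuitableWeakCongr
import Literature.Analysis.FluidPDE.SelfSimilarCollapseAnsatz
import HarnessLib

/-!
# Crux E `PowerGaugeEulerLiouville` (stmt-NavierStokesRegularity-19832): PRESSURE SLAVING on a PAST sub-slab — centring, one-sided
# covariance and cylinder bookkeeping
# (lane «pressure slaving», file 2 = shifted / past strata; LEAD ns-typeII-p2 g11 10:45:58Z (1); width seat ns-ezl-w3 g2)

Route `EulerZoomLiouville` (NavierStokesRegularity), crux E.  The past-exact strata of the census are self-similar about a centre `(T, x₀)`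
on a window `τ < T₁` (`T₁ ≤ 0`, `T₁ ≤ T`): `u τ = fun x => selfSimilarCollapse g T V τ (x − x₀)`.  Centring by the space–time shift
`(s, y) ↦ (T + s, x₀ + y)` (tree `stPull 1 1 T x₀`, `IsDistributionalNSSolutionOn.stRescale` with `α = β = γ = 1`) turns the member into a
distributional Euler solution on the slab `s < −T` which is exactly self-similar ABOUT THE ORIGIN on the window `s < S₁ := T₁ − T ≤ 0`.  That
window is invariant only under the dilations `β ≥ 1` (pushing into the past), and these still fix the velocity:

* `PressureSlaving.stPreimage_one_slab`, `PressureSlaving.isDistributional_shift`, `PressureSlaving.shift_selfSimilar` — the centring;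
* `PressureSlaving.selfSimilar_smul_stPull_apply_of_lt`, `PressureSlaving.slab_le_stPreimage`, `PressureSlaving.isDistributional_rescaledPressure_top`
  — ONE-SIDED COVARIANCE: for `β ≥ 1`, `(w, q_β)`, `q_β(s, y) = β^{2(1−g)} q(β s, β^{g} y)`, is again a distributional Euler solution on the
  window slab with the same velocity;
* `PressureSlaving.parabolicCylinder_shift_subset`, `…_subset_preimage_shift`, `…_subset_preimage_top` — the cylinders hanging from the window
  top used to transport the `D`-growth (`Q_a(T₁, x₀) ⊆ Q_{L a}(0)`, `L = ‖x₀‖ + |T₁| + 2`; `Q_a(S₁, 0) ⊆ Φ_β⁻¹ Q_{L_β a}(S₁, 0)`, `L_β = β + β^g + |S₁| + 1`).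

WHAT THIS IS NOT: not NS regularity, not the crux E — bookkeeping for the census of the crux CLASS 19832 on the MODEL lattice;
`--supports` stmt-19832.  [folklore; CaffarelliKohnNirenberg1982 §2 (scaling covariance); ConstantinIgnatovaVicol2026Putative §3.1 (3.2)]
-/

noncomputable section

-- flat `Theorems/<Route><Decl>…` files of one crux share the namespace of the crux (tree convention: `Summit.<S>.<S>.…`)
set_option linter.dupNamespace false

open MeasureTheory Set Filter Topology Metric Function TopologicalSpace
open scoped ENNReal NNReal

namespace Summit.NavierStokesRegularity.NavierStokesRegularity.Theorems.PowerGaugeEulerLiouville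

open Literature.Analysis Literature.Analysis.FunctionSpaces Literature.Analysis.FluidPDE

namespace PressureSlaving

/-! ### Centring at `(T, x₀)` -/

/-- The shift `(s, y) ↦ (T + s, x₀ + y)` pulls the slab `(−∞, 0) × ℝ³` back to the slab `(−∞, −T) × ℝ³`. [folklore] -/
theorem stPreimage_one_slab (T : ℝ) (x₀ : EuclideanSpace ℝ (Fin 3)) :
    stPreimage 1 1 T x₀ (slab (EuclideanSpace ℝ (Fin 3)) (Iio 0) isOpen_Iio) =
      slab (EuclideanSpace ℝ (Fin 3)) (Iio (-T)) isOpen_Iio := by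
  apply TopologicalSpace.Opens.ext
  ext z
  simp only [coe_stPreimage, coe_slab, mem_preimage, mem_prod, mem_univ, and_true, mem_Iio, stAffine_fst, one_mul]
  constructor <;> intro h <;> linarith

/-- **Centring.**  If `(u, p)` is a distributional Euler solution (no force) on `(−∞,0) × ℝ³`, then the shifted pair
`(s, y) ↦ (u (T + s) (x₀ + y), p (T + s) (x₀ + y))` (`stPull 1 1 T x₀`) is a distributional Euler solution on every slab `(−∞, S₁) × ℝ³` with
`S₁ ≤ −T`. [cite: CaffarelliKohnNirenberg1982, §2] -/
theorem isDistributional_shift {T S₁ : ℝ} (hS : S₁ ≤ -T) (x₀ : EuclideanSpace ℝ (Fin 3))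
    {u : ℝ → EuclideanSpace ℝ (Fin 3) → EuclideanSpace ℝ (Fin 3)} {p : ℝ → EuclideanSpace ℝ (Fin 3) → ℝ}
    (hdist : IsDistributionalNSSolutionOn (slab (EuclideanSpace ℝ (Fin 3)) (Iio 0) isOpen_Iio) 0 0 u p) :
    IsDistributionalNSSolutionOn (slab (EuclideanSpace ℝ (Fin 3)) (Iio S₁) isOpen_Iio) 0 0
      (stPull 1 1 T x₀ u) (stPull 1 1 T x₀ p) := by
  have h := hdist.stRescale (α := 1) (γ := 1) (β := 1) one_pos one_pos (by norm_num) T x₀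
  rw [stPreimage_one_slab, mul_zero, zero_div] at h
  have h0 : ((1 : ℝ) ^ 2 * 1) • stPull 1 1 T x₀ (0 : ℝ → EuclideanSpace ℝ (Fin 3) → EuclideanSpace ℝ (Fin 3)) = 0 := by
    funext s y
    rw [smul_stPull_apply]
    simp
  rw [h0, one_pow, one_smul, one_smul] at h
  exact h.of_le (slab_mono (Iio_subset_Iio hS))

/-- **The centred velocity is exactly self-similar about the origin on the window** `s < T₁ − T`:
`u (T + s) (x₀ + y) = selfSimilarCollapse g 0 V s y`. [folklore; ConstantinIgnatovaVicol2026Putative §3.1 (3.2)] -/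
theorem shift_selfSimilar {g T T₁ : ℝ} {x₀ : EuclideanSpace ℝ (Fin 3)}
    {u : ℝ → EuclideanSpace ℝ (Fin 3) → EuclideanSpace ℝ (Fin 3)} {V : EuclideanSpace ℝ (Fin 3) → EuclideanSpace ℝ (Fin 3)}
    (hu : ∀ τ : ℝ, τ < T₁ → u τ = fun x => selfSimilarCollapse g T V τ (x - x₀)) :
    ∀ s : ℝ, s < T₁ - T → stPull 1 1 T x₀ u s = selfSimilarCollapse g 0 V s := by
  intro s hs
  funext y
  rw [stPull_apply, one_mul, one_smul, hu (T + s) (by linarith)]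
  simp only [selfSimilarCollapse_apply, add_sub_cancel_left, sub_add_cancel_left, zero_sub]

/-! ### One-sided covariance on the window slab `(−∞, S₁) × ℝ³`, `S₁ ≤ 0`, dilations `β ≥ 1` -/

/-- **The rescaling `(β^{1−g}, β, β^{g})`, `β ≥ 1`, fixes a velocity that is exactly self-similar about the origin on the window `s < S₁ ≤ 0`**
(pointwise on the window): `β^{1−g} w(β s, β^{g} y) = w(s, y)` for `s < S₁`. [folklore] -/
theorem selfSimilar_smul_stPull_apply_of_lt {g β S₁ : ℝ} (hβ1 : 1 ≤ β) (hS : S₁ ≤ 0)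
    {w : ℝ → EuclideanSpace ℝ (Fin 3) → EuclideanSpace ℝ (Fin 3)} {V : EuclideanSpace ℝ (Fin 3) → EuclideanSpace ℝ (Fin 3)}
    (hw : ∀ s : ℝ, s < S₁ → w s = selfSimilarCollapse g 0 V s) {s : ℝ} (hs : s < S₁) (y : EuclideanSpace ℝ (Fin 3)) :
    (β ^ (1 - g) • stPull β (β ^ g) 0 (0 : EuclideanSpace ℝ (Fin 3)) w) s y = w s y := by
  have hβ : 0 < β := one_pos.trans_le hβ1
  have hs0 : s < 0 := hs.trans_le hS
  have hβs : β * s < S₁ := by nlinarith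
  rw [smul_stPull_apply, zero_add, zero_add, hw _ hβs, hw s hs]
  simp only [selfSimilarCollapse_apply, zero_sub]
  have hns : 0 ≤ -s := (neg_pos.2 hs0).le
  have e1 : -(β * s) = β * (-s) := by ring
  rw [e1, Real.mul_rpow hβ.le hns, Real.mul_rpow hβ.le hns, smul_smul, smul_smul]
  have e2 : β ^ (1 - g) * (β ^ (g - 1) * (-s) ^ (g - 1)) = (-s) ^ (g - 1) := by
    rw [← mul_assoc, ← Real.rpow_add hβ, show (1 - g) + (g - 1) = 0 by ring, Real.rpow_zero, one_mul]
  have e3 : β ^ (-g) * (-s) ^ (-g) * β ^ g = (-s) ^ (-g) := by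
    rw [mul_comm, ← mul_assoc, ← Real.rpow_add hβ, show g + -g = 0 by ring, Real.rpow_zero, one_mul]
  rw [e2, e3]

/-- For `β ≥ 1` and `S₁ ≤ 0` the dilation `(s, y) ↦ (β s, γ y)` maps the window slab `(−∞, S₁) × ℝ³` INTO itself. [folklore] -/
theorem slab_le_stPreimage {β S₁ : ℝ} (hβ1 : 1 ≤ β) (hS : S₁ ≤ 0) (γ : ℝ) :
    slab (EuclideanSpace ℝ (Fin 3)) (Iio S₁) isOpen_Iio ≤
      stPreimage β γ 0 (0 : EuclideanSpace ℝ (Fin 3)) (slab (EuclideanSpace ℝ (Fin 3)) (Iio S₁) isOpen_Iio) := by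
  intro z hz
  have hz1 : z.1 < S₁ := (mem_slab.1 hz)
  rw [mem_stPreimage, mem_slab, stAffine_fst, zero_add, mem_Iio]
  have hz0 : z.1 < 0 := hz1.trans_le hS
  nlinarith

/-- **ONE-SIDED COVARIANCE.**  If `(w, q)` is a distributional Euler solution (no force) on the window slab `(−∞, S₁) × ℝ³`, `S₁ ≤ 0`, and
`w s = selfSimilarCollapse g 0 V s` for `s < S₁`, then for every `β ≥ 1` the pair `(w, q_β)`, `q_β = (β^{1−g})² • stPull β β^{g} 0 0 q`
(`q_β(s, y) = β^{2(1−g)} q(β s, β^{g} y)`), is a distributional Euler solution on the window slab with the SAME velocity.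
[cite: CaffarelliKohnNirenberg1982, §2] -/
theorem isDistributional_rescaledPressure_top {g β S₁ : ℝ} (hβ1 : 1 ≤ β) (hS : S₁ ≤ 0)
    {w : ℝ → EuclideanSpace ℝ (Fin 3) → EuclideanSpace ℝ (Fin 3)} {q : ℝ → EuclideanSpace ℝ (Fin 3) → ℝ}
    {V : EuclideanSpace ℝ (Fin 3) → EuclideanSpace ℝ (Fin 3)}
    (hdist : IsDistributionalNSSolutionOn (slab (EuclideanSpace ℝ (Fin 3)) (Iio S₁) isOpen_Iio) 0 0 w q)
    (hw : ∀ s : ℝ, s < S₁ → w s = selfSimilarCollapse g 0 V s) :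
    IsDistributionalNSSolutionOn (slab (EuclideanSpace ℝ (Fin 3)) (Iio S₁) isOpen_Iio) 0 0 w
      ((β ^ (1 - g)) ^ 2 • stPull β (β ^ g) 0 (0 : EuclideanSpace ℝ (Fin 3)) q) := by
  have hβ : 0 < β := one_pos.trans_le hβ1
  have hα : 0 < β ^ (1 - g) := Real.rpow_pos_of_pos hβ _
  have hγ : 0 < β ^ g := Real.rpow_pos_of_pos hβ _
  have hβeq : β = β ^ (1 - g) * β ^ g := by
    rw [← Real.rpow_add hβ, show (1 - g) + g = 1 by ring, Real.rpow_one]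
  have h := hdist.stRescale hα hγ hβeq 0 (0 : EuclideanSpace ℝ (Fin 3))
  rw [mul_zero, zero_div] at h
  have h0 : ((β ^ (1 - g)) ^ 2 * β ^ g) • stPull β (β ^ g) 0 (0 : EuclideanSpace ℝ (Fin 3))
      (0 : ℝ → EuclideanSpace ℝ (Fin 3) → EuclideanSpace ℝ (Fin 3)) = 0 := by
    funext s y
    rw [smul_stPull_apply]
    simp
  rw [h0] at h
  have h' := h.of_le (slab_le_stPreimage hβ1 hS (β ^ g))
  refine h'.congr_ae ?_ (ae_of_all _ fun _ => rfl)
  rw [coe_slab]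
  filter_upwards [ae_restrict_mem (measurableSet_Iio.prod MeasurableSet.univ)] with z hz
  exact selfSimilar_smul_stPull_apply_of_lt hβ1 hS hw (mem_prod.1 hz).1 z.2

/-! ### Cylinders hanging from the window top -/

/-- `Q_a(T₁, x₀) ⊆ Q_{L a}(0, 0)` with `L = ‖x₀‖ + |T₁| + 2`, for `a ≥ 1` and `T₁ ≤ 0`. [folklore] -/
theorem parabolicCylinder_shift_subset {T₁ : ℝ} (hT₁ : T₁ ≤ 0) (x₀ : EuclideanSpace ℝ (Fin 3)) {a : ℝ} (ha : 1 ≤ a) :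
    parabolicCylinder a (T₁, x₀) ⊆
      parabolicCylinder ((‖x₀‖ + |T₁| + 2) * a) (0 : ℝ × EuclideanSpace ℝ (Fin 3)) := by
  rintro ⟨t, x⟩ hz
  rw [mem_parabolicCylinder] at hz ⊢
  obtain ⟨⟨ht1, ht2⟩, hx⟩ := hz
  simp only [Prod.fst_zero, Prod.snd_zero, zero_sub, dist_zero_right] at ht1 ht2 hx ⊢
  have hT : |T₁| = -T₁ := abs_of_nonpos hT₁
  have hx0 : 0 ≤ ‖x₀‖ := norm_nonneg _
  have hT0 : 0 ≤ |T₁| := abs_nonneg _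
  refine ⟨⟨?_, by linarith⟩, ?_⟩
  · -- `-(L a)² < t`, from `t > T₁ - a²` and `(L a)² ≥ a² + |T₁|`
    have h1 : a ^ 2 + |T₁| ≤ ((‖x₀‖ + |T₁| + 2) * a) ^ 2 := by
      nlinarith [mul_nonneg hx0 hT0, mul_nonneg hT0 (by linarith : (0 : ℝ) ≤ a - 1), sq_nonneg (‖x₀‖ * a), hx0, hT0]
    linarith
  · have h1 : ‖x‖ - ‖x₀‖ ≤ ‖x - x₀‖ := norm_sub_norm_le x x₀
    rw [dist_eq_norm] at hx
    nlinarith [mul_nonneg hx0 (by linarith : (0 : ℝ) ≤ a - 1), mul_nonneg hT0 (by linarith : (0 : ℝ) ≤ a)]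

/-- The shift pulls `Q_a(T₁, x₀)` back to the cylinder `Q_a(T₁ − T, 0)` hanging from the window top. [folklore] -/
theorem parabolicCylinder_subset_preimage_shift (T T₁ : ℝ) (x₀ : EuclideanSpace ℝ (Fin 3)) (a : ℝ) :
    parabolicCylinder a (T₁ - T, (0 : EuclideanSpace ℝ (Fin 3))) ⊆
      stAffine 1 1 T x₀ ⁻¹' parabolicCylinder a (T₁, x₀) := by
  rintro ⟨s, y⟩ hz
  rw [mem_parabolicCylinder] at hz
  rw [mem_preimage, mem_parabolicCylinder]
  simp only [stAffine_fst, stAffine_snd, one_mul, one_smul, dist_zero_right] at hz ⊢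
  obtain ⟨⟨hs1, hs2⟩, hy⟩ := hz
  refine ⟨⟨by linarith, by linarith⟩, ?_⟩
  rwa [dist_eq_norm, add_sub_cancel_left]

/-- `Q_a(S₁, 0) ⊆ Φ_β⁻¹ Q_{L a}(S₁, 0)` for the dilation `Φ_β(s, y) = (β s, γ y)`, `β ≥ 1`, `γ > 0`, `S₁ ≤ 0`, `a ≥ 1`, with `L = β + γ + |S₁| + 1`.
[folklore] -/
theorem parabolicCylinder_subset_preimage_top {β γ S₁ a : ℝ} (hβ1 : 1 ≤ β) (hγ : 0 < γ) (hS : S₁ ≤ 0) (ha : 1 ≤ a) :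
    parabolicCylinder a (S₁, (0 : EuclideanSpace ℝ (Fin 3))) ⊆
      stAffine β γ 0 (0 : EuclideanSpace ℝ (Fin 3)) ⁻¹'
        parabolicCylinder ((β + γ + |S₁| + 1) * a) (S₁, (0 : EuclideanSpace ℝ (Fin 3))) := by
  rintro ⟨s, y⟩ hz
  rw [mem_parabolicCylinder] at hz
  rw [mem_preimage, mem_parabolicCylinder]
  simp only [stAffine_fst, stAffine_snd, zero_add, dist_zero_right, norm_smul, Real.norm_eq_abs, abs_of_pos hγ] at hz ⊢
  obtain ⟨⟨hs1, hs2⟩, hy⟩ := hz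
  have hS' : |S₁| = -S₁ := abs_of_nonpos hS
  have hs0 : s < 0 := hs2.trans_le hS
  refine ⟨⟨?_, by nlinarith⟩, ?_⟩
  · -- `S₁ - (L a)² < β s`, from `β s > β S₁ - β a²` and `(L a)² ≥ β a² + (β - 1) |S₁|`
    have h1 : β * (S₁ - a ^ 2) < β * s := mul_lt_mul_of_pos_left hs1 (one_pos.trans_le hβ1)
    have h2 : β * a ^ 2 + (β - 1) * |S₁| ≤ ((β + γ + |S₁| + 1) * a) ^ 2 := by
      have hL : β + |S₁| + 1 ≤ β + γ + |S₁| + 1 := by linarith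
      have h3 : (β + |S₁| + 1) ^ 2 * a ^ 2 ≤ ((β + γ + |S₁| + 1) * a) ^ 2 := by
        rw [mul_pow]
        exact mul_le_mul_of_nonneg_right (pow_le_pow_left₀ (by positivity) hL 2) (sq_nonneg a)
      have h4 : β + β * |S₁| ≤ (β + |S₁| + 1) ^ 2 := by nlinarith [abs_nonneg S₁]
      have ha2 : 1 ≤ a ^ 2 := by nlinarith
      have h5' : β * |S₁| ≤ β * |S₁| * a ^ 2 :=
        le_mul_of_one_le_right (mul_nonneg (by linarith) (abs_nonneg S₁)) ha2
      have h5 : β * a ^ 2 + (β - 1) * |S₁| ≤ (β + β * |S₁|) * a ^ 2 := by nlinarith [abs_nonneg S₁]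
      have h6 : (β + β * |S₁|) * a ^ 2 ≤ (β + |S₁| + 1) ^ 2 * a ^ 2 := mul_le_mul_of_nonneg_right h4 (sq_nonneg a)
      exact h5.trans (h6.trans h3)
    nlinarith
  · calc γ * ‖y‖ < γ * a := mul_lt_mul_of_pos_left hy hγ
      _ ≤ (β + γ + |S₁| + 1) * a := by nlinarith [abs_nonneg S₁]

end PressureSlaving

end Summit.NavierStokesRegularity.NavierStokesRegularity.Theorems.PowerGaugeEulerLiouville

end
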